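import Mathlib
import Summits.NavierStokesRegularity.NavierStokesRegularity.Theorems.EulerZoomLiouvillePowerGaugeEulerLiouvilleIrrotationalTools
import Summits.NavierStokesRegularity.NavierStokesRegularity.Theorems.EulerZoomLiouvillePowerGaugeEulerLiouvilleGalileanHarmonicShear
import Summits.NavierStokesRegularity.NavierStokesRegularity.Theorems.EulerZoomLiouvillePowerGaugeEulerLiouvilleKillingRotation
import Summits.NavierStokesRegularity.NavierStokesRegularity.Theorems.EulerZoomLiouvillePowerGaugeEulerLiouvilleKillingShear
import Summits.NavierStokesRegularity.NavierStokesRegularity.Theorems.EulerZoomLiouvillePowerGaugeEulerLiouvilleKillingScrewPairing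
import Summits.NavierStokesRegularity.NavierStokesRegularity.Theorems.CoriolisHeadTypeIRateTransport
import Literature.Analysis.FluidPDE.TypeIAncientMildRssPullback
import Literature.Analysis.FluidPDE.DivCurlAnnihilator
import Literature.Analysis.FluidPDE.WeakGradientIBP
import Literature.Analysis.FluidPDE.SolenoidalTruncation
import HarnessLib

/-!
# Crux E `PowerGaugeEulerLiouville` (stmt-NavierStokesRegularity-19832): KILLING-FIELD (SCREW) SHEAR VANISHES UNDER THE A-GAUGE (width seat ns-ezl-w3 g5)

Route №10 `EulerZoomLiouville` (NavierStokesRegularity), crux E.  Union of `GalileanFrames.harmonicShearVanishes` (g4: translations, `B = 0`) and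
`Killing.killingShearVanishes` (this seat: rotations, `b = 0`).  Every Killing field of `ℝ³` is, after recentring, a screw field `κ(y) = By + b` with `B`
skew and `Bb = 0`; if `U ∈ L¹_loc` is weakly divergence-free with slice growth `∫⁻_{B_R}‖U‖² ≤ C R^{1−2ρ}` and the Lie derivative
`L_κ U = DU·κ − BU` is WEAKLY A GRADIENT — `∫ ⟪U, DΦ(z)(Bz + b) − BΦ(z)⟫ = 0` for every smooth compactly supported trace-free `Φ` — then `U` is invariant
under the rigid motions generated by `κ`: `R_{−θ} U(R_θ z + θ b) = U(z)` a.e. for every `θ` (`Killing.screwShearVanishes`).  ROUTE: as in the two special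
cases — `D := R_{−θ}U(S_θ ·) − U` is weakly divergence-free and annihilates curl pairs (`Killing.integral_inner_screw_eq_of_shear`), so its components are
weakly harmonic with sub-volume growth (the transported ball `S_θ(B_r) ⊆ B_{2r}` for `r ≥ ‖θb‖`), hence zero.  This is the analytic input for the
«rigid-frame» strata with NON-confined frames (two-time subtraction of the tested identity makes `L_κ V` weakly a gradient for a Killing field `κ`).

WHAT THIS IS NOT: not NS regularity, not the crux E — a stratum tool of the crux CLASS 19832 (MODEL lattice; E/NS strata), `--supports` stmt-19832;
19832 OPEN. [cite: LemarieRieusset2016, proof of Thm 4.4 pp. 56–57; GilbargTrudinger2001, Thm 2.1]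
-/

noncomputable section

-- flat `Theorems/<Route><Decl>…` files of one crux share the namespace of the crux (tree convention: `Summit.<S>.<S>.…`)
set_option linter.dupNamespace false

open MeasureTheory Set Filter Topology Metric Function TopologicalSpace InnerProductSpace
open scoped ENNReal NNReal RealInnerProductSpace Laplacian ContDiff

namespace Summit.NavierStokesRegularity.NavierStokesRegularity.Theorems.PowerGaugeEulerLiouville

namespace Killing

open Literature.Analysis Literature.Analysis.FunctionSpaces Literature.Analysis.FluidPDE
open Summit.NavierStokesRegularity.NavierStokesRegularity.Theorems.CoriolisHead
open Summit.NavierStokesRegularity.NavierStokesRegularity.Theorems.PowerGaugeEulerLiouville.GalileanFrames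

/-- **SCREW (GENERAL KILLING-FIELD) SHEAR VANISHES UNDER THE A-GAUGE.**  A locally integrable field `U` on `ℝ³`, weakly divergence-free, with the slice growth
`∫⁻_{B_R}‖U‖² ≤ C R^{1−2ρ}` (`R ≥ 1`, `ρ > 0`), and a skew operator `B` (`⟪Bx, x⟫ = 0`) and `b ∈ ker B` such that the Lie derivative `L_κ U = DU·κ − BU` is
weakly a gradient along the screw field `κ(y) = By + b` (`Bb = 0`) — `∫ ⟪U, DΦ(z)(Bz + b) − BΦ(z)⟫ = 0` for every smooth compactly supported
trace-free `Φ` — is invariant under the rigid motions `S_θ z = R_θ z + θ b`: `R_{−θ} U(S_θ ·) = U` a.e. for every `θ` (`b = 0`: `killingShearVanishes`;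
`B = 0`: `GalileanFrames.harmonicShearVanishes`).
[cite: LemarieRieusset2016, proof of Thm 4.4 pp. 56–57; GilbargTrudinger2001, Thm 2.1] -/
theorem screwShearVanishes :
    ∀ ρ : ℝ, 0 < ρ → ∀ (U : EuclideanSpace ℝ (Fin 3) → EuclideanSpace ℝ (Fin 3))
    (B : EuclideanSpace ℝ (Fin 3) →L[ℝ] EuclideanSpace ℝ (Fin 3)) (b : EuclideanSpace ℝ (Fin 3)) (C : ℝ),
    (∀ x, ⟪B x, x⟫ = 0) → B b = 0 →
    LocallyIntegrable U volume →
    (∀ R : ℝ, 1 ≤ R → ∫⁻ z in Metric.ball (0 : EuclideanSpace ℝ (Fin 3)) R, ‖U z‖ₑ ^ 2 ≤ ENNReal.ofReal (C * R ^ (1 - 2 * ρ))) →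
    (∀ φ : EuclideanSpace ℝ (Fin 3) → ℝ, ContDiff ℝ (⊤ : ℕ∞) φ → HasCompactSupport φ → ∫ z, ⟪U z, gradient φ z⟫ = 0) →
    (∀ Φ : EuclideanSpace ℝ (Fin 3) → EuclideanSpace ℝ (Fin 3), ContDiff ℝ (⊤ : ℕ∞) Φ → HasCompactSupport Φ →
      (∀ z, LinearMap.trace ℝ (EuclideanSpace ℝ (Fin 3))
        ((fderiv ℝ Φ z : EuclideanSpace ℝ (Fin 3) →L[ℝ] EuclideanSpace ℝ (Fin 3)) :
          EuclideanSpace ℝ (Fin 3) →ₗ[ℝ] EuclideanSpace ℝ (Fin 3)) = 0) →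
      ∫ z, ⟪U z, (fderiv ℝ Φ z) (B z + b) - B (Φ z)⟫ = 0) →
    ∀ θ : ℝ, (fun z => NormedSpace.exp ((-θ) • B) (U (NormedSpace.exp (θ • B) z + θ • b))) =ᵐ[volume] U := by
  intro ρ hρ U B b C hB hb hUl hgrow hdivU hshear θ
  have hnorm : ∀ (t : ℝ) (v : EuclideanSpace ℝ (Fin 3)), ‖NormedSpace.exp (t • B) v‖ = ‖v‖ := fun t v =>
    TypeIRate.norm_exp_smul_skew hB t v
  have hRc : ∀ t : ℝ, Continuous fun w : EuclideanSpace ℝ (Fin 3) => NormedSpace.exp (t • B) w := fun t =>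
    (NormedSpace.exp (t • B)).continuous
  -- the increment `D = R_{−θ} U(S_θ ·) − U`, `S_θ z = R_θ z + θ b`
  have hUrl : LocallyIntegrable (fun z => U (NormedSpace.exp (θ • B) z + θ • b)) volume :=
    locallyIntegrable_comp_expSkew hB θ (locallyIntegrable_comp_add_right hUl (θ • b))
  have hUsl : LocallyIntegrable (fun z => NormedSpace.exp ((-θ) • B) (U (NormedSpace.exp (θ • B) z + θ • b))) volume := by
    have h := (NormedSpace.exp ((-θ) • B)).locallyIntegrableOn_comp (locallyIntegrableOn_univ.2 hUrl)
    exact locallyIntegrableOn_univ.1 h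
  set D : EuclideanSpace ℝ (Fin 3) → EuclideanSpace ℝ (Fin 3) := fun z =>
    NormedSpace.exp ((-θ) • B) (U (NormedSpace.exp (θ • B) z + θ • b)) - U z with hD
  have hDl : LocallyIntegrable D volume := hUsl.sub hUl
  -- pairings of `D` with test fields split, the first term rotated back onto `U`
  have hsplit : ∀ Ξ : EuclideanSpace ℝ (Fin 3) → EuclideanSpace ℝ (Fin 3),
      IsTestFunctionOn (⊤ : Opens (EuclideanSpace ℝ (Fin 3))) Ξ →
      ∫ z, ⟪D z, Ξ z⟫ = (∫ w, ⟪U w, NormedSpace.exp (θ • B) (Ξ (NormedSpace.exp ((-θ) • B) (w - θ • b)))⟫) - ∫ z, ⟪U z, Ξ z⟫ := by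
    intro Ξ hΞ
    have hΞc : Continuous Ξ := hΞ.contDiff.continuous
    have i1 : Integrable (fun z => ⟪NormedSpace.exp ((-θ) • B) (U (NormedSpace.exp (θ • B) z + θ • b)), Ξ z⟫) volume :=
      integrable_inner_of_locallyIntegrable_of_hasCompactSupport hUsl hΞc hΞ.hasCompactSupport
    have i2 : Integrable (fun z => ⟪U z, Ξ z⟫) volume :=
      integrable_inner_of_locallyIntegrable_of_hasCompactSupport hUl hΞc hΞ.hasCompactSupport
    have e1 : (fun z => ⟪D z, Ξ z⟫) = fun z => ⟪NormedSpace.exp ((-θ) • B) (U (NormedSpace.exp (θ • B) z + θ • b)), Ξ z⟫ - ⟪U z, Ξ z⟫ := by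
      funext z; rw [hD, inner_sub_left]
    -- `∫⟪R_{−θ} U(R_θ z), Ξ z⟫ dz = ∫ G(R_θ z) dz = ∫ G` with `G w = ⟪U w, R_θ Ξ(R_{−θ} w)⟫`
    have e3 : (∫ z, ⟪NormedSpace.exp ((-θ) • B) (U (NormedSpace.exp (θ • B) z + θ • b)), Ξ z⟫) =
        ∫ w, ⟪U w, NormedSpace.exp (θ • B) (Ξ (NormedSpace.exp ((-θ) • B) (w - θ • b)))⟫ := by
      have h := integral_comp_screw hB θ b (fun w => ⟪U w, NormedSpace.exp (θ • B) (Ξ (NormedSpace.exp ((-θ) • B) (w - θ • b)))⟫)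
      beta_reduce at h
      rw [← h]
      refine integral_congr_ae (ae_of_all _ fun z => ?_)
      simp only [inner_expSkew_left hB, neg_neg, add_sub_cancel_right, expSkew_neg_apply_expSkew]
    rw [e1, integral_sub i1 i2, e3]
  -- (1) `D` is weakly divergence-free
  have hDdiv : IsWeaklyDivFree D := by
    intro φ hφ
    have hφd : Differentiable ℝ φ := hφ.contDiff.differentiable (by simp)
    set ψ : EuclideanSpace ℝ (Fin 3) → ℝ := fun x => φ (NormedSpace.exp ((-θ) • B) (x - θ • b)) with hψ
    have hψs : ContDiff ℝ (⊤ : ℕ∞) ψ :=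
      hφ.contDiff.comp ((NormedSpace.exp ((-θ) • B)).contDiff.comp (contDiff_id.sub contDiff_const))
    have hψc : HasCompactSupport ψ := hasCompactSupport_comp_screwInv hB (-θ) (θ • b) hφ.hasCompactSupport
    -- the gradient field of `φ` is a test field, and its rotate is the gradient field of `ψ`
    have hG : IsTestFunctionOn (⊤ : Opens (EuclideanSpace ℝ (Fin 3))) (gradient φ) :=
      { contDiff := by
          refine contDiff_infty.2 fun n => ?_
          exact (InnerProductSpace.toDual ℝ (EuclideanSpace ℝ (Fin 3))).symm.contDiff.comp
            (hφ.contDiff.fderiv_right (m := n) (by exact_mod_cast le_top))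
        hasCompactSupport := (hφ.hasCompactSupport.fderiv (𝕜 := ℝ)).comp_left
          (g := (InnerProductSpace.toDual ℝ (EuclideanSpace ℝ (Fin 3))).symm) (map_zero _)
        tsupport_subset := by simp }
    have hgrad : ∀ w, NormedSpace.exp (θ • B) (gradient φ (NormedSpace.exp ((-θ) • B) (w - θ • b))) = gradient ψ w := by
      intro w
      have h1 : HasFDerivAt (fun x : EuclideanSpace ℝ (Fin 3) => NormedSpace.exp ((-θ) • B) (x - θ • b)) (NormedSpace.exp ((-θ) • B)) w := by
        have h := (NormedSpace.exp ((-θ) • B)).hasFDerivAt.comp w ((hasFDerivAt_id w).sub_const (θ • b))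
        rw [ContinuousLinearMap.comp_id] at h
        exact h
      have hd : HasFDerivAt ψ ((fderiv ℝ φ (NormedSpace.exp ((-θ) • B) (w - θ • b))).comp (NormedSpace.exp ((-θ) • B))) w :=
        ((hφd _).hasFDerivAt).comp w h1
      symm
      apply ext_inner_right ℝ
      intro v
      rw [gradient, hd.fderiv, InnerProductSpace.toDual_symm_apply, inner_expSkew_left hB, gradient,
        InnerProductSpace.toDual_symm_apply]
      rfl
    rw [hsplit _ hG]
    simp_rw [hgrad]
    rw [hdivU ψ hψs hψc, hdivU φ hφ.contDiff hφ.hasCompactSupport, sub_zero]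
  -- (2) `D` annihilates every curl pair
  have hDcurl : ∀ g : EuclideanSpace ℝ (Fin 3) → ℝ, IsTestFunctionOn (⊤ : Opens (EuclideanSpace ℝ (Fin 3))) g →
      ∀ a c : EuclideanSpace ℝ (Fin 3), ∫ x, ⟪D x, fderiv ℝ g x a • c - fderiv ℝ g x c • a⟫ = 0 := by
    intro g hg a c
    set Ξ : EuclideanSpace ℝ (Fin 3) → EuclideanSpace ℝ (Fin 3) := fun x => fderiv ℝ g x a • c - fderiv ℝ g x c • a with hΞ
    have hΞt : IsTestFunctionOn (⊤ : Opens (EuclideanSpace ℝ (Fin 3))) Ξ := isTestFunctionOn_curlPair hg a c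
    have hΞd : Differentiable ℝ Ξ := hΞt.contDiff.differentiable (by simp)
    -- every transport `Ξ_t = R_t Ξ(X_t ·)` is a trace-free test field, so the shear hypothesis applies to it
    have horth : ∀ t : ℝ, ∫ w, ⟪U w, NormedSpace.exp (t • B) (fderiv ℝ Ξ (NormedSpace.exp ((-t) • B) (w - t • b)) (B (NormedSpace.exp ((-t) • B) (w - t • b)) + b)) -
        B (NormedSpace.exp (t • B) (Ξ (NormedSpace.exp ((-t) • B) (w - t • b))))⟫ = 0 := by
      intro t
      have hs : ContDiff ℝ (⊤ : ℕ∞) (fun w => NormedSpace.exp (t • B) (Ξ (NormedSpace.exp ((-t) • B) (w - t • b)))) :=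
        (NormedSpace.exp (t • B)).contDiff.comp
          (hΞt.contDiff.comp ((NormedSpace.exp ((-t) • B)).contDiff.comp (contDiff_id.sub contDiff_const)))
      have hc : HasCompactSupport (fun w => NormedSpace.exp (t • B) (Ξ (NormedSpace.exp ((-t) • B) (w - t • b)))) :=
        (hasCompactSupport_comp_screwInv hB (-t) (t • b) hΞt.hasCompactSupport).comp_left (map_zero _)
      have htr : ∀ z, LinearMap.trace ℝ (EuclideanSpace ℝ (Fin 3))
          ((fderiv ℝ (fun w => NormedSpace.exp (t • B) (Ξ (NormedSpace.exp ((-t) • B) (w - t • b)))) z :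
            EuclideanSpace ℝ (Fin 3) →L[ℝ] EuclideanSpace ℝ (Fin 3)) : EuclideanSpace ℝ (Fin 3) →ₗ[ℝ] EuclideanSpace ℝ (Fin 3)) = 0 := by
        intro z
        rw [(hasFDerivAt_screwRotate B t (t • b) hΞd z).fderiv, trace_rotate_conj, hΞ]
        exact trace_fderiv_curlPair hg.contDiff a c _
      have h := hshear _ hs hc htr
      have e : ∀ z : EuclideanSpace ℝ (Fin 3), NormedSpace.exp ((-t) • B) (B z + b) = B (NormedSpace.exp ((-t) • B) (z - t • b)) + b := by
        intro z
        simp only [map_add, map_sub, map_smul, expSkew_apply_of_ker hb, hb, smul_zero, sub_zero, TypeIRate.exp_smul_apply_comm]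
      simpa only [(hasFDerivAt_screwRotate B t (t • b) hΞd _).fderiv, ContinuousLinearMap.comp_apply, e] using h
    rw [hsplit Ξ hΞt, integral_inner_screw_eq_of_shear hB hb hUl hΞt horth θ, sub_self]
  -- (3) growth of `D` on balls
  set m : ℝ := 1 - 2 * ρ with hm
  have hm3 : m < 3 := by rw [hm]; linarith
  set Cp : ℝ := max C 0 with hCp
  have hCp0 : 0 ≤ Cp := le_max_right _ _
  have hgrow' : ∀ R : ℝ, 1 ≤ R → ∫⁻ z in ball (0 : EuclideanSpace ℝ (Fin 3)) R, ‖U z‖ₑ ^ 2 ≤ ENNReal.ofReal (Cp * R ^ m) := by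
    intro R hR
    refine (hgrow R hR).trans (ENNReal.ofReal_le_ofReal ?_)
    exact mul_le_mul_of_nonneg_right (le_max_left _ _) (Real.rpow_nonneg (by linarith) _)
  set r₀ : ℝ := max 1 ‖θ • b‖ with hr₀
  have hDgrowth : ∀ r : ℝ, r₀ < r → 0 < r →
      ∫⁻ z in ball (0 : EuclideanSpace ℝ (Fin 3)) r, ‖D z‖ₑ ^ 2 ≤ ENNReal.ofReal (4 * Cp * ((2 : ℝ) ^ m + 1) * r ^ m) := by
    intro r hr hr0
    have hr1 : 1 ≤ r := le_trans (le_max_left _ _) hr.le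
    have hrs : ‖θ • b‖ ≤ r := le_trans (le_max_right _ _) hr.le
    -- pointwise: `‖D‖² ≤ 4(‖U(S_θ ·)‖² + ‖U‖²)`
    have hpt : ∀ z, ‖D z‖ₑ ^ 2 ≤ 4 * (‖U (NormedSpace.exp (θ • B) z + θ • b)‖ₑ ^ 2 + ‖U z‖ₑ ^ 2) := by
      intro z
      have e1 : ‖NormedSpace.exp ((-θ) • B) (U (NormedSpace.exp (θ • B) z + θ • b))‖ₑ = ‖U (NormedSpace.exp (θ • B) z + θ • b)‖ₑ := by
        rw [← ofReal_norm, ← ofReal_norm, hnorm]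
      calc ‖D z‖ₑ ^ 2 ≤ (‖NormedSpace.exp ((-θ) • B) (U (NormedSpace.exp (θ • B) z + θ • b))‖ₑ + ‖U z‖ₑ) ^ 2 := by
            rw [hD]; gcongr; exact enorm_sub_le
        _ = (‖U (NormedSpace.exp (θ • B) z + θ • b)‖ₑ + ‖U z‖ₑ) ^ 2 := by rw [e1]
        _ ≤ _ := ENNReal.add_sq_le_four_mul _ _
    -- the transported ball integral: rotate, translate, enlarge
    have hUm : AEMeasurable (fun z => ‖U (NormedSpace.exp (θ • B) z + θ • b)‖ₑ ^ 2) (volume.restrict (ball (0 : EuclideanSpace ℝ (Fin 3)) r)) :=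
      (hUrl.aestronglyMeasurable.enorm.pow_const 2).restrict
    have htrans : ∫⁻ z in ball (0 : EuclideanSpace ℝ (Fin 3)) r, ‖U (NormedSpace.exp (θ • B) z + θ • b)‖ₑ ^ 2 ≤
        ENNReal.ofReal (Cp * (2 * r) ^ m) := by
      rw [setLIntegral_ball_comp_expSkew hB θ (fun y => ‖U (y + θ • b)‖ₑ ^ 2) r,
        setLIntegral_ball_comp_add_right (fun y => ‖U y‖ₑ ^ 2) (θ • b) r]
      have hsub : ball (θ • b) r ⊆ ball (0 : EuclideanSpace ℝ (Fin 3)) (2 * r) := by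
        intro y hy
        rw [mem_ball, dist_eq_norm] at hy
        rw [mem_ball_zero_iff]
        calc ‖y‖ ≤ ‖y - θ • b‖ + ‖θ • b‖ := norm_le_norm_sub_add y (θ • b)
          _ < r + r := add_lt_add_of_lt_of_le hy hrs
          _ = 2 * r := by ring
      exact (lintegral_mono_set hsub).trans (hgrow' (2 * r) (by linarith))
    calc ∫⁻ z in ball (0 : EuclideanSpace ℝ (Fin 3)) r, ‖D z‖ₑ ^ 2
        ≤ ∫⁻ z in ball (0 : EuclideanSpace ℝ (Fin 3)) r, 4 * (‖U (NormedSpace.exp (θ • B) z + θ • b)‖ₑ ^ 2 + ‖U z‖ₑ ^ 2) :=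
          lintegral_mono fun z => hpt z
      _ = 4 * ((∫⁻ z in ball (0 : EuclideanSpace ℝ (Fin 3)) r, ‖U (NormedSpace.exp (θ • B) z + θ • b)‖ₑ ^ 2) +
            ∫⁻ z in ball (0 : EuclideanSpace ℝ (Fin 3)) r, ‖U z‖ₑ ^ 2) := by
          rw [lintegral_const_mul' _ _ (by norm_num), lintegral_add_left' hUm]
      _ ≤ 4 * (ENNReal.ofReal (Cp * (2 * r) ^ m) + ENNReal.ofReal (Cp * r ^ m)) :=
          mul_le_mul' le_rfl (add_le_add htrans (hgrow' r hr1))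
      _ = ENNReal.ofReal (4 * Cp * ((2 : ℝ) ^ m + 1) * r ^ m) := by
          rw [← ENNReal.ofReal_add (by positivity) (by positivity), ← ENNReal.ofReal_ofNat 4,
            ← ENNReal.ofReal_mul (by norm_num), Real.mul_rpow (by norm_num) hr0.le]
          congr 1
          ring
  -- (4) every coordinate of `D` is weakly harmonic with the same growth, hence zero
  have hcoord : ∀ i : Fin 3, (fun x => ⟪D x, EuclideanSpace.single i (1 : ℝ)⟫) =ᵐ[volume] 0 := by
    intro i
    set a : EuclideanSpace ℝ (Fin 3) := EuclideanSpace.single i (1 : ℝ) with ha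
    have ha1 : ‖a‖ = 1 := by rw [ha, PiLp.norm_single, norm_one]
    refine ae_eq_zero_of_weaklyHarmonic_of_growth (K := 4 * Cp * ((2 : ℝ) ^ m + 1)) (m := m) (r₀ := r₀) ?_ ?_ hm3 ?_
    · have e1 : (fun x => ⟪D x, a⟫) = fun x => (innerSL ℝ a) (D x) := by
        funext x; simp only [innerSL_apply_apply, real_inner_comm]
      rw [e1, ← locallyIntegrableOn_univ]
      exact (innerSL ℝ a).locallyIntegrableOn_comp (locallyIntegrableOn_univ.2 hDl)
    · intro φ hφ hφc
      have hθ' : IsTestFunctionOn (⊤ : Opens (EuclideanSpace ℝ (Fin 3))) φ := ⟨hφ, hφc, by simp⟩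
      have := integral_laplacian_mul_inner_eq_zero_of_curlPair hDl hDdiv hDcurl hθ' a
      rw [← this]
      exact integral_congr_ae (Eventually.of_forall fun x => by simp only [mul_comm])
    · intro r hr hr0
      refine le_trans (lintegral_mono fun x => ?_) (hDgrowth r hr hr0)
      gcongr
      rw [← ofReal_norm, ← ofReal_norm]
      exact ENNReal.ofReal_le_ofReal ((norm_inner_le_norm _ _).trans (by rw [ha1, mul_one]))
  have hall := ae_all_iff.2 hcoord
  filter_upwards [hall] with x hx
  have hDx : D x = 0 := by
    ext i
    have h1 := hx i
    simp only [Pi.zero_apply] at h1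
    rw [EuclideanSpace.inner_single_right] at h1
    simpa using h1
  have : NormedSpace.exp ((-θ) • B) (U (NormedSpace.exp (θ • B) x + θ • b)) - U x = 0 := hDx
  exact sub_eq_zero.1 this


end Killing

end Summit.NavierStokesRegularity.NavierStokesRegularity.Theorems.PowerGaugeEulerLiouville

end
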